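import Literature.NumberTheory.Transcendental.KZCalculus
import Literature.NumberTheory.Transcendental.SemialgebraicMapsProofs
import HarnessLib

/-!
# Semialgebraic families of moves of the Kontsevich–Zagier calculus

Vocabulary only (no facts). Next to `Literature/NumberTheory/Transcendental/KZCalculus.lean`,
which fixes the four moves `KZ.domainAddRel`, `KZ.integrandAddRel`, `KZ.changeOfVariablesRel`,
`KZ.newtonLeibnizRel ⊆ KZ.FormalRep` of the Kontsevich–Zagier calculus [KZ 2001, §1.2], this file
defines *families* of move instances, and of chains of moves, indexed by a real parameter `t`
ranging over a set `T ⊆ ℝ`, all of whose data vary `ℚ`-semialgebraically with the parameter: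

* `KZ.totalSet T S`, `KZ.totalFun f`, `KZ.totalMap Φ` — total space / total function / total map
  of a family over `T`, the parameter being the **last** coordinate:
  `totalSet T S = {z : ℝⁿ⁺¹ | z last ∈ T ∧ init z ∈ S (z last)}` (the `Fin.snoc`/`Fin.init`
  convention of route StandardParts, item SpArcClosure);
* `KZ.IsSemialgebraicSetFamilyOn T S`, `KZ.IsSemialgebraicFunFamilyOn T S f`,
  `KZ.IsSemialgebraicMapFamilyOn T S Φ` — on `T`, the family is cut out fibrewise
  (`x ↦ Fin.snoc x t`) from ONE ambient `ℚ`-semialgebraic set / function / map of `(x, t)`;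
* `KZ.IntegralRep.IsSemialgebraicFamilyOn T R` — for `R : ℝ → KZ.IntegralRep n`: the domains and
  the integrands form such families;
* `KZ.IsDomainAddFamilyOn`, `KZ.IsIntegrandAddFamilyOn`, `KZ.IsChangeOfVariablesFamilyOn`,
  `KZ.IsNewtonLeibnizFamilyOn T C` — for `C : ℝ → KZ.FormalRep`: for every `t ∈ T`, `C t` is an
  instance of the corresponding move, witnessed by data (representations `r_t, r₁_t, r₂_t / r'_t`,
  the map `Φ_t` with derivative `Φ'_t`, the band functions `a_t ≤ b_t`, the primitive `F_t`)
  satisfying *verbatim* the clauses of the move at each `t ∈ T`, and moreover `ℚ`-semialgebraic in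
  `(x, t)`: all representations are semialgebraic families over `T`, and `Φ`, `a`, `b`, `F` are
  semialgebraic function / map families over `T` on the relevant domains;
* `KZ.IsMoveFamilyOn T C` — the disjunction over the four moves; `KZ.MoveFamilyOn T` — the same,
  bundled;
* `KZ.UniformlyEquivalentOn T R R'` — "one template of `k` moves whose data vary semialgebraically
  with `t`": `∃ k (C : Fin k → ℝ → FormalRep) (s : Fin k → ℤ)`, every `C i` a move family on `T`,
  with `of (R t) - of (R' t) = ∑ i, s i • C i t` for all `t ∈ T`.

## Main statements (sanity lemmas, all proved)

* `KZ.IsMoveFamilyOn.mem_relations` — each fibre `C t`, `t ∈ T`, of a move family is a relation;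
  `KZ.UniformlyEquivalentOn.equivalent` — uniform equivalence on `T` implies `KZ.Equivalent (R t)
  (R' t)` for every `t ∈ T`.
* `KZ.isMoveFamilyOn_const` — the constant family of one fixed move instance is a move family over
  any `T`; `KZ.Equivalent.uniformlyEquivalentOn_const` — hence `KZ.Equivalent r r'` makes the
  constant families uniformly equivalent over any `T` (so on constant families the new notion is
  exactly `KZ.Equivalent`).
* `KZ.IsMoveFamilyOn.mono`, `KZ.UniformlyEquivalentOn.mono` — restriction to `T' ⊆ T`.
* `KZ.IntegralRep.IsSemialgebraicFamilyOn.of_totalSet` — the hypotheses of SpArcClosure's shape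
  (total domain over `T` is `ℚ`-semialgebraic, total integrand is a `ℚ`-semialgebraic function on
  it) give a semialgebraic family, for any `T`; conversely
  `KZ.IntegralRep.IsSemialgebraicFamilyOn.isSemialgebraic_totalSet` /
  `isSemialgebraicFunOn_totalFun` when `T` is itself `ℚ`-semialgebraic.

## References

* M. Kontsevich, D. Zagier, *Periods*, in: Mathematics Unlimited — 2001 and Beyond, Springer
  (2001), §1.2 (the three rules).
* J. Bochnak, M. Coste, M.-F. Roy, *Real Algebraic Geometry*, Springer (1998), §2.2
  (semialgebraic maps), Thm. 9.3.2 (Hardt triviality, the intended use of the families).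
* L. van den Dries, *Tame topology and o-minimal structures*, LMS LN 248, CUP (1998), Ch. 9
  (definable families, fibrewise properties).

## Design notes

* Mathlib has no semialgebraic sets or maps (searched `emialgebraic`, `definable famil`); the tree's
  `Literature.ModelTheory.ExponentialFields.IsSemialgebraic`, `IsSemialgebraicFunOn`,
  `IsSemialgebraicMapOn` are used, with `k = ℚ`, `R = ℝ` as in `KZCalculus`.
* "Semialgebraic in `(x, t)` on `T`" is phrased through an AMBIENT semialgebraic object whose fibres
  over `t ∈ T` are the given ones (`IsSemialgebraicSetFamilyOn` etc.), rather than by asking the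
  total space *over `T`* to be semialgebraic. For `ℚ`-semialgebraic `T` (e.g. `T = Set.Ioo 0 1`) the
  two are equivalent (`of_totalSet`, `isSemialgebraic_totalSet`, `isSemialgebraicFunOn_totalFun`);
  the ambient form is the one that stays meaningful for parameter sets which are not semialgebraic
  (e.g. `T = Set.Ioo 0 1 ∩ {algebraic numbers}` or `T = {1/N | N ≥ 1}`, see the next note), and it
  makes restriction to any `T' ⊆ T` and constant families hypothesis-free.
* Caveat recorded for users (elementary definability, [folklore]): `KZ.IntegralRep` carries
  *fibrewise* `ℚ`-semialgebraicity, so for a family `R : ℝ → KZ.IntegralRep n` with `ℚ`-semialgebraic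
  total domain the fibre over a *transcendental* `t` is a `ℚ`-semialgebraic fibre of a
  `ℚ`-semialgebraic family; the set of parameters with a given `∅`-definable fibre is `∅`-definable in
  `(ℝ, +, ·, <)`, hence a finite union of intervals with real-algebraic endpoints, so it is a
  neighbourhood of `t`: such families are locally constant near every transcendental parameter, hence
  piecewise constant off finitely many algebraic parameters. Non-trivial `t`-dependence of the fibres
  `R t` therefore only occurs along algebraic parameters (e.g. `T ⊆ Set.Ioo 0 1 ∩ ℚ̄`), which the
  ambient formulation supports. Nothing in this file depends on this remark.
* The fibrewise clauses of each move are copied verbatim from `KZCalculus` (including the fibrewise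
  semialgebraicity of `Φ_t`, `a_t`, `b_t`, `F_t`, which does not follow from the ambient one at
  transcendental `t`), so that `IsMoveFamilyOn.mem_relations` holds by construction; as in
  `KZ.changeOfVariablesRel`, no semialgebraicity is asked of the derivative `Φ'`.
-/

noncomputable section

open MeasureTheory Set

namespace Literature.NumberTheory.Transcendental

namespace KZ

open Literature.ModelTheory.ExponentialFields (IsSemialgebraic)

variable {n m l : ℕ}

/-! ### Total spaces of families over a parameter set `T ⊆ ℝ` (parameter = last coordinate) -/

/-- The total space over `T ⊆ ℝ` of a family `S : ℝ → Set ℝⁿ` of sets, with the parameter as the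
last coordinate: `{z : ℝⁿ⁺¹ | z last ∈ T ∧ init z ∈ S (z last)}`, i.e. the union over `t ∈ T` of
`(S t) × {t}`. [van den Dries 1998, Ch. 9 (definable families)] [folklore] -/
def totalSet (T : Set ℝ) (S : ℝ → Set (Fin n → ℝ)) : Set (Fin (n + 1) → ℝ) :=
  {z | z (Fin.last n) ∈ T ∧ Fin.init z ∈ S (z (Fin.last n))}

/-- The total function `(x, t) ↦ f t x` of a family `f : ℝ → (ℝⁿ → ℝ)` of scalar functions
(parameter = last coordinate). [van den Dries 1998, Ch. 9] [folklore] -/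
def totalFun (f : ℝ → (Fin n → ℝ) → ℝ) : (Fin (n + 1) → ℝ) → ℝ :=
  fun z => f (z (Fin.last n)) (Fin.init z)

/-- The total map `(x, t) ↦ Φ t x` of a family `Φ : ℝ → (ℝⁿ → ℝᵐ)` of maps (parameter = last
coordinate). [van den Dries 1998, Ch. 9] [folklore] -/
def totalMap (Φ : ℝ → (Fin n → ℝ) → (Fin m → ℝ)) : (Fin (n + 1) → ℝ) → (Fin m → ℝ) :=
  fun z => Φ (z (Fin.last n)) (Fin.init z)

/-- Membership in the total space. [folklore] -/
@[simp] theorem mem_totalSet {T : Set ℝ} {S : ℝ → Set (Fin n → ℝ)} {z : Fin (n + 1) → ℝ} :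
    z ∈ totalSet T S ↔ z (Fin.last n) ∈ T ∧ Fin.init z ∈ S (z (Fin.last n)) := Iff.rfl

/-- `(x, t)` lies in the total space over `T` iff `t ∈ T` and `x ∈ S t`. [folklore] -/
theorem snoc_mem_totalSet {T : Set ℝ} {S : ℝ → Set (Fin n → ℝ)} {x : Fin n → ℝ} {t : ℝ} :
    Fin.snoc x t ∈ totalSet T S ↔ t ∈ T ∧ x ∈ S t := by
  simp [totalSet]

/-- Unfolding of the total function. [folklore] -/
@[simp] theorem totalFun_apply (f : ℝ → (Fin n → ℝ) → ℝ) (z : Fin (n + 1) → ℝ) :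
    totalFun f z = f (z (Fin.last n)) (Fin.init z) := rfl

/-- The total function at `(x, t)` is `f t x`. [folklore] -/
theorem totalFun_snoc (f : ℝ → (Fin n → ℝ) → ℝ) (x : Fin n → ℝ) (t : ℝ) :
    totalFun f (Fin.snoc x t) = f t x := by
  simp [totalFun]

/-- Unfolding of the total map. [folklore] -/
@[simp] theorem totalMap_apply (Φ : ℝ → (Fin n → ℝ) → (Fin m → ℝ)) (z : Fin (n + 1) → ℝ) :
    totalMap Φ z = Φ (z (Fin.last n)) (Fin.init z) := rfl

/-- The total map at `(x, t)` is `Φ t x`. [folklore] -/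
theorem totalMap_snoc (Φ : ℝ → (Fin n → ℝ) → (Fin m → ℝ)) (x : Fin n → ℝ) (t : ℝ) :
    totalMap Φ (Fin.snoc x t) = Φ t x := by
  simp [totalMap]

/-- Total spaces are monotone in the parameter set. [folklore] -/
theorem totalSet_mono {T T' : Set ℝ} (h : T' ⊆ T) (S : ℝ → Set (Fin n → ℝ)) :
    totalSet T' S ⊆ totalSet T S := fun _ hz => ⟨h hz.1, hz.2⟩

/-- The total space over `T ∩ T'` is the part of the total space over `T` lying over `T'`.
[folklore] -/
theorem totalSet_inter (T T' : Set ℝ) (S : ℝ → Set (Fin n → ℝ)) :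
    totalSet (T ∩ T') S = totalSet T S ∩ {z | z (Fin.last n) ∈ T'} := by
  ext z
  simp only [mem_totalSet, mem_inter_iff, mem_setOf_eq]
  tauto

/-- If `T ⊆ ℝ` is `ℚ`-semialgebraic (as a subset of `ℝ¹`) then so is the cylinder
`{z : ℝⁿ⁺¹ | z last ∈ T}`. [BCR 1998, §2.1] [folklore] -/
theorem isSemialgebraic_setOf_last_mem {T : Set ℝ}
    (hT : IsSemialgebraic ℚ {x : Fin 1 → ℝ | x 0 ∈ T}) :
    IsSemialgebraic ℚ {z : Fin (n + 1) → ℝ | z (Fin.last n) ∈ T} :=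
  hT.preimage_comp fun _ : Fin 1 => Fin.last n

/-! ### Semialgebraic families of sets, functions and maps over `T` -/

/-- A family `S : ℝ → Set ℝⁿ` of sets is a `ℚ`-semialgebraic family on `T ⊆ ℝ` if there is ONE
`ℚ`-semialgebraic set `D ⊆ ℝⁿ⁺¹` whose fibres `{x | (x, t) ∈ D}` over `t ∈ T` are the sets `S t`
("`S|_T` is a definable family, defined over `ℚ`"). For `ℚ`-semialgebraic `T` this is equivalent to
the total space `totalSet T S` being `ℚ`-semialgebraic (`of_totalSet`, `isSemialgebraic_totalSet`).
[van den Dries 1998, Ch. 9; BCR 1998, §2.2] [folklore] -/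
def IsSemialgebraicSetFamilyOn (T : Set ℝ) (S : ℝ → Set (Fin n → ℝ)) : Prop :=
  ∃ D : Set (Fin (n + 1) → ℝ), IsSemialgebraic ℚ D ∧ ∀ t ∈ T, S t = {x | Fin.snoc x t ∈ D}

/-- A family `f : ℝ → (ℝⁿ → ℝ)` of scalar functions is a `ℚ`-semialgebraic family on the fibres
`S t`, `t ∈ T`, if there is ONE `ℚ`-semialgebraic function `g` of `(x, t)`, on a set containing the
total space `totalSet T S`, with `f t x = g (x, t)` for `t ∈ T`, `x ∈ S t`.
[van den Dries 1998, Ch. 9; BCR 1998, Def. 2.2.5] [folklore] -/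
def IsSemialgebraicFunFamilyOn (T : Set ℝ) (S : ℝ → Set (Fin n → ℝ)) (f : ℝ → (Fin n → ℝ) → ℝ) :
    Prop :=
  ∃ (D : Set (Fin (n + 1) → ℝ)) (g : (Fin (n + 1) → ℝ) → ℝ), IsSemialgebraicFunOn ℚ D g ∧
    totalSet T S ⊆ D ∧ ∀ t ∈ T, EqOn (f t) (fun x => g (Fin.snoc x t)) (S t)

/-- A family `Φ : ℝ → (ℝⁿ → ℝᵐ)` of maps is a `ℚ`-semialgebraic family on the fibres `S t`,
`t ∈ T`, if there is ONE `ℚ`-semialgebraic map `Ψ` of `(x, t)`, on a set containing the total space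
`totalSet T S`, with `Φ t x = Ψ (x, t)` for `t ∈ T`, `x ∈ S t`.
[van den Dries 1998, Ch. 9; BCR 1998, Def. 2.2.5] [folklore] -/
def IsSemialgebraicMapFamilyOn (T : Set ℝ) (S : ℝ → Set (Fin n → ℝ))
    (Φ : ℝ → (Fin n → ℝ) → (Fin m → ℝ)) : Prop :=
  ∃ (D : Set (Fin (n + 1) → ℝ)) (Ψ : (Fin (n + 1) → ℝ) → (Fin m → ℝ)), IsSemialgebraicMapOn ℚ D Ψ ∧
    totalSet T S ⊆ D ∧ ∀ t ∈ T, EqOn (Φ t) (fun x => Ψ (Fin.snoc x t)) (S t)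

namespace IsSemialgebraicSetFamilyOn

variable {T T' : Set ℝ} {S : ℝ → Set (Fin n → ℝ)}

/-- Restriction of a semialgebraic family of sets to a smaller parameter set. [folklore] -/
theorem mono (h : IsSemialgebraicSetFamilyOn T S) (hT : T' ⊆ T) : IsSemialgebraicSetFamilyOn T' S := by
  obtain ⟨D, hD, hS⟩ := h
  exact ⟨D, hD, fun t ht => hS t (hT ht)⟩

/-- A family of sets whose total space over `T` is `ℚ`-semialgebraic is a semialgebraic family on
`T` (take the total space itself as the ambient set). [folklore] -/
theorem of_totalSet (h : IsSemialgebraic ℚ (totalSet T S)) : IsSemialgebraicSetFamilyOn T S :=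
  ⟨totalSet T S, h, fun t ht => Set.ext fun x => by simp [ht]⟩

/-- Over a `ℚ`-semialgebraic parameter set, the total space of a semialgebraic family of sets is
`ℚ`-semialgebraic. [folklore] -/
theorem isSemialgebraic_totalSet (h : IsSemialgebraicSetFamilyOn T S)
    (hT : IsSemialgebraic ℚ {x : Fin 1 → ℝ | x 0 ∈ T}) : IsSemialgebraic ℚ (totalSet T S) := by
  obtain ⟨D, hD, hS⟩ := h
  convert (isSemialgebraic_setOf_last_mem (n := n) hT).inter hD using 1
  ext z
  simp only [mem_totalSet, mem_inter_iff, mem_setOf_eq]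
  constructor
  · rintro ⟨hz, hx⟩
    refine ⟨hz, ?_⟩
    rw [hS _ hz] at hx
    simpa [Fin.snoc_init_self] using hx
  · rintro ⟨hz, hzD⟩
    refine ⟨hz, ?_⟩
    rw [hS _ hz]
    simpa [Fin.snoc_init_self] using hzD

end IsSemialgebraicSetFamilyOn

/-- A constant family of sets with `ℚ`-semialgebraic value is a semialgebraic family over any `T`
(ambient set: the cylinder `{z | init z ∈ s}`). [folklore] -/
theorem isSemialgebraicSetFamilyOn_const (T : Set ℝ) {s : Set (Fin n → ℝ)}
    (hs : IsSemialgebraic ℚ s) : IsSemialgebraicSetFamilyOn T (fun _ => s) :=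
  ⟨{z | Fin.init z ∈ s}, hs.setOf_init_mem, fun t _ => Set.ext fun x => by simp⟩

namespace IsSemialgebraicFunFamilyOn

variable {T T' : Set ℝ} {S : ℝ → Set (Fin n → ℝ)} {f : ℝ → (Fin n → ℝ) → ℝ}

/-- Restriction of a semialgebraic family of functions to a smaller parameter set. [folklore] -/
theorem mono (h : IsSemialgebraicFunFamilyOn T S f) (hT : T' ⊆ T) :
    IsSemialgebraicFunFamilyOn T' S f := by
  obtain ⟨D, g, hg, hsub, hf⟩ := h
  exact ⟨D, g, hg, (totalSet_mono hT S).trans hsub, fun t ht => hf t (hT ht)⟩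

/-- A family of functions whose total function is `ℚ`-semialgebraic on the total space over `T` is
a semialgebraic family on `T`. [folklore] -/
theorem of_totalSet (h : IsSemialgebraicFunOn ℚ (totalSet T S) (totalFun f)) :
    IsSemialgebraicFunFamilyOn T S f :=
  ⟨totalSet T S, totalFun f, h, Subset.rfl, fun t _ x _ => by simp⟩

/-- Over a `ℚ`-semialgebraic parameter set (more precisely: when the total space over `T` is
`ℚ`-semialgebraic), the total function of a semialgebraic family of functions is `ℚ`-semialgebraic
on the total space. [folklore] -/
theorem isSemialgebraicFunOn_totalFun (h : IsSemialgebraicFunFamilyOn T S f)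
    (hT : IsSemialgebraic ℚ (totalSet T S)) : IsSemialgebraicFunOn ℚ (totalSet T S) (totalFun f) := by
  obtain ⟨D, g, hg, hsub, hf⟩ := h
  refine (hg.mono hsub hT).congr fun z hz => ?_
  have hz' := hz
  rw [mem_totalSet] at hz'
  have := hf _ hz'.1 hz'.2
  simp only [Fin.snoc_init_self] at this
  simpa [totalFun] using this.symm

end IsSemialgebraicFunFamilyOn

/-- A constant family of functions with `ℚ`-semialgebraic value on `s` is a semialgebraic family
over any `T` on the constant fibres `s` (ambient function `(x, t) ↦ f x` on the cylinder over `s`,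
`IsSemialgebraicFunOn.comp_init`). [folklore] -/
theorem isSemialgebraicFunFamilyOn_const (T : Set ℝ) {s : Set (Fin n → ℝ)} {f : (Fin n → ℝ) → ℝ}
    (hf : IsSemialgebraicFunOn ℚ s f) : IsSemialgebraicFunFamilyOn T (fun _ => s) (fun _ => f) :=
  ⟨{z | Fin.init z ∈ s}, fun z => f (Fin.init z), hf.comp_init, fun _ hz => hz.2,
    fun t _ x _ => by simp⟩

namespace IsSemialgebraicMapFamilyOn

variable {T T' : Set ℝ} {S : ℝ → Set (Fin n → ℝ)} {Φ : ℝ → (Fin n → ℝ) → (Fin m → ℝ)}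

/-- Restriction of a semialgebraic family of maps to a smaller parameter set. [folklore] -/
theorem mono (h : IsSemialgebraicMapFamilyOn T S Φ) (hT : T' ⊆ T) :
    IsSemialgebraicMapFamilyOn T' S Φ := by
  obtain ⟨D, Ψ, hΨ, hsub, hΦ⟩ := h
  exact ⟨D, Ψ, hΨ, (totalSet_mono hT S).trans hsub, fun t ht => hΦ t (hT ht)⟩

/-- A family of maps whose total map is `ℚ`-semialgebraic on the total space over `T` is a
semialgebraic family on `T`. [folklore] -/
theorem of_totalSet (h : IsSemialgebraicMapOn ℚ (totalSet T S) (totalMap Φ)) :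
    IsSemialgebraicMapFamilyOn T S Φ :=
  ⟨totalSet T S, totalMap Φ, h, Subset.rfl, fun t _ x _ => by simp⟩

/-- When the total space over `T` is `ℚ`-semialgebraic, the total map of a semialgebraic family of
maps is `ℚ`-semialgebraic on it. [folklore] -/
theorem isSemialgebraicMapOn_totalMap (h : IsSemialgebraicMapFamilyOn T S Φ)
    (hT : IsSemialgebraic ℚ (totalSet T S)) : IsSemialgebraicMapOn ℚ (totalSet T S) (totalMap Φ) := by
  obtain ⟨D, Ψ, hΨ, hsub, hΦ⟩ := h
  refine (hΨ.mono hsub hT).congr fun z hz => ?_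
  have hz' := hz
  rw [mem_totalSet] at hz'
  have := hΦ _ hz'.1 hz'.2
  simp only [Fin.snoc_init_self] at this
  simpa [totalMap] using this.symm

end IsSemialgebraicMapFamilyOn

/-- The coordinate projection `Fin.init : ℝⁿ⁺¹ → ℝⁿ` is a `ℚ`-semialgebraic map on any
`ℚ`-semialgebraic set (a polynomial map). [BCR 1998, §2.2] [folklore] -/
theorem isSemialgebraicMapOn_init {D : Set (Fin (n + 1) → ℝ)} (hD : IsSemialgebraic ℚ D) :
    IsSemialgebraicMapOn ℚ D (Fin.init : (Fin (n + 1) → ℝ) → (Fin n → ℝ)) := by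
  convert isSemialgebraicMapOn_aeval hD (fun i : Fin n => MvPolynomial.X (Fin.castSucc i)) using 2
    with z
  ext i
  simp [Fin.init]

/-- A constant family of maps with `ℚ`-semialgebraic value on `s` is a semialgebraic family over
any `T` on the constant fibres `s` (ambient map `(x, t) ↦ Φ x = (Φ ∘ init) (x, t)` on the cylinder
over `s`; composition of semialgebraic maps, Tarski–Seidenberg). [BCR 1998, Prop. 2.2.6] [folklore] -/
theorem isSemialgebraicMapFamilyOn_const (T : Set ℝ) {s : Set (Fin n → ℝ)}
    {Φ : (Fin n → ℝ) → (Fin m → ℝ)} (hΦ : IsSemialgebraicMapOn ℚ s Φ) :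
    IsSemialgebraicMapFamilyOn T (fun _ => s) (fun _ => Φ) := by
  have hs : IsSemialgebraic ℚ s := IsSemialgebraicMapOn.isSemialgebraic_holds hΦ
  refine ⟨{z | Fin.init z ∈ s}, Φ ∘ Fin.init, ?_, fun _ hz => hz.2, fun t _ x _ => by simp⟩
  exact IsSemialgebraicMapOn.comp_holds hΦ (isSemialgebraicMapOn_init hs.setOf_init_mem)
    fun z hz => hz

/-! ### Semialgebraic families of integral representations -/

/-- A family `R : ℝ → KZ.IntegralRep n` of integral representations is a `ℚ`-semialgebraic family on
`T ⊆ ℝ` if its domains form a `ℚ`-semialgebraic family of sets on `T` and its integrands a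
`ℚ`-semialgebraic family of functions on these domains: all data vary semialgebraically with the
parameter. For `ℚ`-semialgebraic `T` this is exactly: the total domain
`{z | z last ∈ T ∧ init z ∈ (R (z last)).domain}` is `ℚ`-semialgebraic and the total integrand
`z ↦ (R (z last)).integrand (init z)` is a `ℚ`-semialgebraic function on it (`of_totalSet` and its
converses). [Kontsevich–Zagier 2001, §1.2; van den Dries 1998, Ch. 9] [folklore] -/
structure IntegralRep.IsSemialgebraicFamilyOn (T : Set ℝ) (R : ℝ → IntegralRep n) : Prop where
  /-- The domains form a semialgebraic family of sets on `T`. -/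
  domain : IsSemialgebraicSetFamilyOn T fun t => (R t).domain
  /-- The integrands form a semialgebraic family of functions on the domains. -/
  integrand : IsSemialgebraicFunFamilyOn T (fun t => (R t).domain) fun t => (R t).integrand

namespace IntegralRep.IsSemialgebraicFamilyOn

variable {T T' : Set ℝ} {R : ℝ → IntegralRep n}

/-- Restriction of a semialgebraic family of representations to a smaller parameter set.
[folklore] -/
theorem mono (h : IsSemialgebraicFamilyOn T R) (hT : T' ⊆ T) : IsSemialgebraicFamilyOn T' R :=
  ⟨h.domain.mono hT, h.integrand.mono hT⟩

/-- **From the hypotheses of SpArcClosure's shape**: if the total domain over `T` is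
`ℚ`-semialgebraic and the total integrand is a `ℚ`-semialgebraic function on it, the family is
semialgebraic on `T` (any `T`). [folklore] -/
theorem of_totalSet (hD : IsSemialgebraic ℚ (totalSet T fun t => (R t).domain))
    (hf : IsSemialgebraicFunOn ℚ (totalSet T fun t => (R t).domain)
      (totalFun fun t => (R t).integrand)) :
    IsSemialgebraicFamilyOn T R :=
  ⟨IsSemialgebraicSetFamilyOn.of_totalSet hD, IsSemialgebraicFunFamilyOn.of_totalSet hf⟩

/-- Converse, for a `ℚ`-semialgebraic parameter set: the total domain is `ℚ`-semialgebraic.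
[folklore] -/
theorem isSemialgebraic_totalSet (h : IsSemialgebraicFamilyOn T R)
    (hT : IsSemialgebraic ℚ {x : Fin 1 → ℝ | x 0 ∈ T}) :
    IsSemialgebraic ℚ (totalSet T fun t => (R t).domain) :=
  h.domain.isSemialgebraic_totalSet hT

/-- Converse, for a `ℚ`-semialgebraic parameter set: the total integrand is `ℚ`-semialgebraic on the
total domain. [folklore] -/
theorem isSemialgebraicFunOn_totalFun (h : IsSemialgebraicFamilyOn T R)
    (hT : IsSemialgebraic ℚ {x : Fin 1 → ℝ | x 0 ∈ T}) :
    IsSemialgebraicFunOn ℚ (totalSet T fun t => (R t).domain) (totalFun fun t => (R t).integrand) :=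
  h.integrand.isSemialgebraicFunOn_totalFun (h.isSemialgebraic_totalSet hT)

end IntegralRep.IsSemialgebraicFamilyOn

/-- A constant family of representations is a semialgebraic family over any `T`. [folklore] -/
theorem IntegralRep.isSemialgebraicFamilyOn_const (T : Set ℝ) (r : IntegralRep n) :
    IntegralRep.IsSemialgebraicFamilyOn T fun _ => r :=
  ⟨isSemialgebraicSetFamilyOn_const T r.isSemialgebraic_domain,
    isSemialgebraicFunFamilyOn_const T r.isSemialgebraicFunOn_integrand⟩

/-! ### Semialgebraic families of move instances -/

/-- **Family of instances of move (1a), additivity in the domain**, over `T ⊆ ℝ`: three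
`ℚ`-semialgebraic families `r, r₁, r₂ : ℝ → IntegralRep n` on `T` such that for every `t ∈ T` the
clauses of `KZ.domainAddRel` hold verbatim for `(r t, r₁ t, r₂ t)` and `C t = [r t] − [r₁ t] − [r₂ t]`.
[Kontsevich–Zagier 2001, §1.2, rule (1)] [folklore] -/
def IsDomainAddFamilyOn (T : Set ℝ) (C : ℝ → FormalRep) : Prop :=
  ∃ (n : ℕ) (r r₁ r₂ : ℝ → IntegralRep n),
    IntegralRep.IsSemialgebraicFamilyOn T r ∧ IntegralRep.IsSemialgebraicFamilyOn T r₁ ∧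
    IntegralRep.IsSemialgebraicFamilyOn T r₂ ∧
    ∀ t ∈ T, (r t).domain = (r₁ t).domain ∪ (r₂ t).domain ∧
      volume ((r₁ t).domain ∩ (r₂ t).domain) = 0 ∧
      EqOn (r t).integrand (r₁ t).integrand (r₁ t).domain ∧
      EqOn (r t).integrand (r₂ t).integrand (r₂ t).domain ∧
      C t = of (r t) - of (r₁ t) - of (r₂ t)

/-- **Family of instances of move (1b), additivity in the integrand**, over `T ⊆ ℝ`: three
`ℚ`-semialgebraic families `r, r₁, r₂ : ℝ → IntegralRep n` on `T` such that for every `t ∈ T` the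
clauses of `KZ.integrandAddRel` hold verbatim and `C t = [r t] − [r₁ t] − [r₂ t]`.
[Kontsevich–Zagier 2001, §1.2, rule (1)] [folklore] -/
def IsIntegrandAddFamilyOn (T : Set ℝ) (C : ℝ → FormalRep) : Prop :=
  ∃ (n : ℕ) (r r₁ r₂ : ℝ → IntegralRep n),
    IntegralRep.IsSemialgebraicFamilyOn T r ∧ IntegralRep.IsSemialgebraicFamilyOn T r₁ ∧
    IntegralRep.IsSemialgebraicFamilyOn T r₂ ∧
    ∀ t ∈ T, (r₁ t).domain = (r t).domain ∧ (r₂ t).domain = (r t).domain ∧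
      EqOn (r t).integrand ((r₁ t).integrand + (r₂ t).integrand) (r t).domain ∧
      C t = of (r t) - of (r₁ t) - of (r₂ t)

/-- **Family of instances of move (2), change of variables**, over `T ⊆ ℝ`: `ℚ`-semialgebraic
families `r, r' : ℝ → IntegralRep n` on `T`, a family of maps `Φ_t` which is a `ℚ`-semialgebraic
family on the domains of `r` (i.e. `(x, t) ↦ Φ_t x` is one semialgebraic map), and derivatives
`Φ'_t`, such that for every `t ∈ T` the clauses of `KZ.changeOfVariablesRel` hold verbatim for
`(r t, r' t, Φ t, Φ' t)` and `C t = [r t] − [r' t]`. As in the move itself, nothing is asked of `Φ'`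
beyond being a derivative of `Φ_t` within the domain.
[Kontsevich–Zagier 2001, §1.2, rule (2)] [folklore] -/
def IsChangeOfVariablesFamilyOn (T : Set ℝ) (C : ℝ → FormalRep) : Prop :=
  ∃ (n : ℕ) (r r' : ℝ → IntegralRep n) (Φ : ℝ → (Fin n → ℝ) → (Fin n → ℝ))
    (Φ' : ℝ → (Fin n → ℝ) → (Fin n → ℝ) →L[ℝ] (Fin n → ℝ)),
    IntegralRep.IsSemialgebraicFamilyOn T r ∧ IntegralRep.IsSemialgebraicFamilyOn T r' ∧
    IsSemialgebraicMapFamilyOn T (fun t => (r t).domain) Φ ∧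
    ∀ t ∈ T, IsSemialgebraicMapOn ℚ (r t).domain (Φ t) ∧
      (∀ x ∈ (r t).domain, HasFDerivWithinAt (Φ t) (Φ' t x) (r t).domain x) ∧
      InjOn (Φ t) (r t).domain ∧ (r' t).domain = Φ t '' (r t).domain ∧
      (∀ x ∈ (r t).domain, (r t).integrand x = (r' t).integrand (Φ t x) * |(Φ' t x).det|) ∧
      C t = of (r t) - of (r' t)

/-- **Family of instances of move (3), Newton–Leibniz along the last coordinate**, over `T ⊆ ℝ`:
`ℚ`-semialgebraic families `r : ℝ → IntegralRep (n + 1)` (the bands) and `r' : ℝ → IntegralRep n`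
(the bases) on `T`, band functions `a_t ≤ b_t` forming `ℚ`-semialgebraic families on the bases, and
primitives `F_t` forming a `ℚ`-semialgebraic family on the bands, such that for every `t ∈ T` the
clauses of `KZ.newtonLeibnizRel` hold verbatim for `(r t, r' t, a t, b t, F t)` and
`C t = [r t] − [r' t]`. [Kontsevich–Zagier 2001, §1.2, rule (3)] [folklore] -/
def IsNewtonLeibnizFamilyOn (T : Set ℝ) (C : ℝ → FormalRep) : Prop :=
  ∃ (n : ℕ) (r : ℝ → IntegralRep (n + 1)) (r' : ℝ → IntegralRep n) (a b : ℝ → (Fin n → ℝ) → ℝ)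
    (F : ℝ → (Fin (n + 1) → ℝ) → ℝ),
    IntegralRep.IsSemialgebraicFamilyOn T r ∧ IntegralRep.IsSemialgebraicFamilyOn T r' ∧
    IsSemialgebraicFunFamilyOn T (fun t => (r' t).domain) a ∧
    IsSemialgebraicFunFamilyOn T (fun t => (r' t).domain) b ∧
    IsSemialgebraicFunFamilyOn T (fun t => (r t).domain) F ∧
    ∀ t ∈ T, IsSemialgebraicFunOn ℚ (r t).domain (F t) ∧
      IsSemialgebraicFunOn ℚ (r' t).domain (a t) ∧ IsSemialgebraicFunOn ℚ (r' t).domain (b t) ∧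
      (∀ x ∈ (r' t).domain, a t x ≤ b t x) ∧
      (r t).domain = {z | (Fin.init z : Fin n → ℝ) ∈ (r' t).domain ∧
        a t (Fin.init z) ≤ z (Fin.last n) ∧ z (Fin.last n) ≤ b t (Fin.init z)} ∧
      (∀ x ∈ (r' t).domain, ContinuousOn (fun s : ℝ => F t (Fin.snoc x s)) (Icc (a t x) (b t x))) ∧
      (∀ x ∈ (r' t).domain, ∀ s ∈ Ioo (a t x) (b t x),
        HasDerivAt (fun u : ℝ => F t (Fin.snoc x u)) ((r t).integrand (Fin.snoc x s)) s) ∧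
      (∀ x ∈ (r' t).domain,
        (r' t).integrand x = F t (Fin.snoc x (b t x)) - F t (Fin.snoc x (a t x))) ∧
      C t = of (r t) - of (r' t)

/-- **A `ℚ`-semialgebraic family of move instances over `T ⊆ ℝ`**: `C : ℝ → KZ.FormalRep` is, on
`T`, a semialgebraic family of instances of ONE of the four moves of the KZ calculus (domain
additivity, integrand additivity, change of variables, Newton–Leibniz).
[Kontsevich–Zagier 2001, §1.2] [folklore] -/
def IsMoveFamilyOn (T : Set ℝ) (C : ℝ → FormalRep) : Prop :=
  IsDomainAddFamilyOn T C ∨ IsIntegrandAddFamilyOn T C ∨ IsChangeOfVariablesFamilyOn T C ∨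
    IsNewtonLeibnizFamilyOn T C

/-- Bundled form of `KZ.IsMoveFamilyOn`: a `ℚ`-semialgebraic family of move instances over `T`
("a template of one move whose data vary semialgebraically with `t ∈ T`").
[Kontsevich–Zagier 2001, §1.2] [folklore] -/
structure MoveFamilyOn (T : Set ℝ) where
  /-- The underlying family of formal combinations. -/
  toFun : ℝ → FormalRep
  /-- It is a semialgebraic family of instances of one move on `T`. -/
  isMoveFamilyOn : IsMoveFamilyOn T toFun

/-- **Uniform equivalence of two families of representations on `T ⊆ ℝ`**: there is ONE template —
finitely many `ℚ`-semialgebraic move families `C i` over `T` and integer multiplicities `s i` — with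
`[R t] − [R' t] = ∑ i, s i • C i t` for every `t ∈ T`. In particular `R t` and `R' t` are
`KZ.Equivalent` for each `t ∈ T` (`UniformlyEquivalentOn.equivalent`), by a chain of moves of
bounded length whose data vary semialgebraically with `t`.
[Kontsevich–Zagier 2001, §1.2] [folklore] -/
def UniformlyEquivalentOn (T : Set ℝ) (R : ℝ → IntegralRep n) (R' : ℝ → IntegralRep m) : Prop :=
  ∃ (k : ℕ) (C : Fin k → ℝ → FormalRep) (s : Fin k → ℤ),
    (∀ i, IsMoveFamilyOn T (C i)) ∧ ∀ t ∈ T, of (R t) - of (R' t) = ∑ i, s i • C i t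

/-! ### Fibres of move families are move instances -/

section Fibres

variable {T T' : Set ℝ} {C : ℝ → FormalRep} {t : ℝ}

/-- Each fibre over `T` of a domain-additivity family is an instance of the move. [folklore] -/
theorem IsDomainAddFamilyOn.mem (h : IsDomainAddFamilyOn T C) (ht : t ∈ T) : C t ∈ domainAddRel := by
  obtain ⟨n, r, r₁, r₂, -, -, -, hC⟩ := h
  obtain ⟨h₁, h₂, h₃, h₄, h₅⟩ := hC t ht
  exact ⟨n, r t, r₁ t, r₂ t, h₁, h₂, h₃, h₄, h₅⟩

/-- Each fibre over `T` of an integrand-additivity family is an instance of the move. [folklore] -/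
theorem IsIntegrandAddFamilyOn.mem (h : IsIntegrandAddFamilyOn T C) (ht : t ∈ T) :
    C t ∈ integrandAddRel := by
  obtain ⟨n, r, r₁, r₂, -, -, -, hC⟩ := h
  obtain ⟨h₁, h₂, h₃, h₄⟩ := hC t ht
  exact ⟨n, r t, r₁ t, r₂ t, h₁, h₂, h₃, h₄⟩

/-- Each fibre over `T` of a change-of-variables family is an instance of the move. [folklore] -/
theorem IsChangeOfVariablesFamilyOn.mem (h : IsChangeOfVariablesFamilyOn T C) (ht : t ∈ T) :
    C t ∈ changeOfVariablesRel := by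
  obtain ⟨n, r, r', Φ, Φ', -, -, -, hC⟩ := h
  obtain ⟨h₁, h₂, h₃, h₄, h₅, h₆⟩ := hC t ht
  exact ⟨n, r t, r' t, Φ t, Φ' t, h₁, h₂, h₃, h₄, h₅, h₆⟩

/-- Each fibre over `T` of a Newton–Leibniz family is an instance of the move. [folklore] -/
theorem IsNewtonLeibnizFamilyOn.mem (h : IsNewtonLeibnizFamilyOn T C) (ht : t ∈ T) :
    C t ∈ newtonLeibnizRel := by
  obtain ⟨n, r, r', a, b, F, -, -, -, -, -, hC⟩ := h
  obtain ⟨h₁, h₂, h₃, h₄, h₅, h₆, h₇, h₈, h₉⟩ := hC t ht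
  exact ⟨n, r t, r' t, a t, b t, F t, h₁, h₂, h₃, h₄, h₅, h₆, h₇, h₈, h₉⟩

/-- Each fibre over `T` of a move family is an instance of one of the four moves. [folklore] -/
theorem IsMoveFamilyOn.mem (h : IsMoveFamilyOn T C) (ht : t ∈ T) :
    C t ∈ domainAddRel ∪ integrandAddRel ∪ changeOfVariablesRel ∪ newtonLeibnizRel := by
  rcases h with h | h | h | h
  · exact Or.inl (Or.inl (Or.inl (h.mem ht)))
  · exact Or.inl (Or.inl (Or.inr (h.mem ht)))
  · exact Or.inl (Or.inr (h.mem ht))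
  · exact Or.inr (h.mem ht)

/-- **Each fibre over `T` of a move family is a relation of the KZ calculus.**
[Kontsevich–Zagier 2001, §1.2] [folklore] -/
theorem IsMoveFamilyOn.mem_relations (h : IsMoveFamilyOn T C) (ht : t ∈ T) : C t ∈ relations :=
  AddSubgroup.subset_closure (h.mem ht)

/-! ### Restriction to a smaller parameter set -/

/-- Restriction of a domain-additivity family. [folklore] -/
theorem IsDomainAddFamilyOn.mono (h : IsDomainAddFamilyOn T C) (hT : T' ⊆ T) :
    IsDomainAddFamilyOn T' C := by
  obtain ⟨n, r, r₁, r₂, hr, hr₁, hr₂, hC⟩ := h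
  exact ⟨n, r, r₁, r₂, hr.mono hT, hr₁.mono hT, hr₂.mono hT, fun t ht => hC t (hT ht)⟩

/-- Restriction of an integrand-additivity family. [folklore] -/
theorem IsIntegrandAddFamilyOn.mono (h : IsIntegrandAddFamilyOn T C) (hT : T' ⊆ T) :
    IsIntegrandAddFamilyOn T' C := by
  obtain ⟨n, r, r₁, r₂, hr, hr₁, hr₂, hC⟩ := h
  exact ⟨n, r, r₁, r₂, hr.mono hT, hr₁.mono hT, hr₂.mono hT, fun t ht => hC t (hT ht)⟩

/-- Restriction of a change-of-variables family. [folklore] -/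
theorem IsChangeOfVariablesFamilyOn.mono (h : IsChangeOfVariablesFamilyOn T C) (hT : T' ⊆ T) :
    IsChangeOfVariablesFamilyOn T' C := by
  obtain ⟨n, r, r', Φ, Φ', hr, hr', hΦ, hC⟩ := h
  exact ⟨n, r, r', Φ, Φ', hr.mono hT, hr'.mono hT, hΦ.mono hT, fun t ht => hC t (hT ht)⟩

/-- Restriction of a Newton–Leibniz family. [folklore] -/
theorem IsNewtonLeibnizFamilyOn.mono (h : IsNewtonLeibnizFamilyOn T C) (hT : T' ⊆ T) :
    IsNewtonLeibnizFamilyOn T' C := by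
  obtain ⟨n, r, r', a, b, F, hr, hr', ha, hb, hF, hC⟩ := h
  exact ⟨n, r, r', a, b, F, hr.mono hT, hr'.mono hT, ha.mono hT, hb.mono hT, hF.mono hT,
    fun t ht => hC t (hT ht)⟩

/-- **Restriction of a move family to a smaller parameter set.** [folklore] -/
theorem IsMoveFamilyOn.mono (h : IsMoveFamilyOn T C) (hT : T' ⊆ T) : IsMoveFamilyOn T' C := by
  rcases h with h | h | h | h
  · exact Or.inl (h.mono hT)
  · exact Or.inr (Or.inl (h.mono hT))
  · exact Or.inr (Or.inr (Or.inl (h.mono hT)))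
  · exact Or.inr (Or.inr (Or.inr (h.mono hT)))

/-- Restriction of a bundled move family. [folklore] -/
def MoveFamilyOn.restrict (C : MoveFamilyOn T) (hT : T' ⊆ T) : MoveFamilyOn T' :=
  ⟨C.toFun, C.isMoveFamilyOn.mono hT⟩

/-- Restriction does not change the underlying family. [folklore] -/
@[simp] theorem MoveFamilyOn.toFun_restrict (C : MoveFamilyOn T) (hT : T' ⊆ T) :
    (C.restrict hT).toFun = C.toFun := rfl

/-! ### Constant families -/

/-- A constant family of ONE instance of domain additivity is a domain-additivity family over any
`T`. [folklore] -/
theorem isDomainAddFamilyOn_const (T : Set ℝ) {c : FormalRep} (hc : c ∈ domainAddRel) :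
    IsDomainAddFamilyOn T fun _ => c := by
  obtain ⟨n, r, r₁, r₂, h₁, h₂, h₃, h₄, rfl⟩ := hc
  exact ⟨n, fun _ => r, fun _ => r₁, fun _ => r₂, IntegralRep.isSemialgebraicFamilyOn_const T r,
    IntegralRep.isSemialgebraicFamilyOn_const T r₁, IntegralRep.isSemialgebraicFamilyOn_const T r₂,
    fun _ _ => ⟨h₁, h₂, h₃, h₄, rfl⟩⟩

/-- A constant family of ONE instance of integrand additivity is an integrand-additivity family
over any `T`. [folklore] -/
theorem isIntegrandAddFamilyOn_const (T : Set ℝ) {c : FormalRep} (hc : c ∈ integrandAddRel) :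
    IsIntegrandAddFamilyOn T fun _ => c := by
  obtain ⟨n, r, r₁, r₂, h₁, h₂, h₃, rfl⟩ := hc
  exact ⟨n, fun _ => r, fun _ => r₁, fun _ => r₂, IntegralRep.isSemialgebraicFamilyOn_const T r,
    IntegralRep.isSemialgebraicFamilyOn_const T r₁, IntegralRep.isSemialgebraicFamilyOn_const T r₂,
    fun _ _ => ⟨h₁, h₂, h₃, rfl⟩⟩

/-- A constant family of ONE instance of change of variables is a change-of-variables family over
any `T`. [folklore] -/
theorem isChangeOfVariablesFamilyOn_const (T : Set ℝ) {c : FormalRep} (hc : c ∈ changeOfVariablesRel) :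
    IsChangeOfVariablesFamilyOn T fun _ => c := by
  obtain ⟨n, r, r', Φ, Φ', h₁, h₂, h₃, h₄, h₅, rfl⟩ := hc
  exact ⟨n, fun _ => r, fun _ => r', fun _ => Φ, fun _ => Φ',
    IntegralRep.isSemialgebraicFamilyOn_const T r, IntegralRep.isSemialgebraicFamilyOn_const T r',
    isSemialgebraicMapFamilyOn_const T h₁, fun _ _ => ⟨h₁, h₂, h₃, h₄, h₅, rfl⟩⟩

/-- A constant family of ONE instance of Newton–Leibniz is a Newton–Leibniz family over any `T`.
[folklore] -/
theorem isNewtonLeibnizFamilyOn_const (T : Set ℝ) {c : FormalRep} (hc : c ∈ newtonLeibnizRel) :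
    IsNewtonLeibnizFamilyOn T fun _ => c := by
  obtain ⟨n, r, r', a, b, F, h₁, h₂, h₃, h₄, h₅, h₆, h₇, h₈, rfl⟩ := hc
  exact ⟨n, fun _ => r, fun _ => r', fun _ => a, fun _ => b, fun _ => F,
    IntegralRep.isSemialgebraicFamilyOn_const T r, IntegralRep.isSemialgebraicFamilyOn_const T r',
    isSemialgebraicFunFamilyOn_const T h₂, isSemialgebraicFunFamilyOn_const T h₃,
    isSemialgebraicFunFamilyOn_const T h₁,
    fun _ _ => ⟨h₁, h₂, h₃, h₄, h₅, h₆, h₇, h₈, rfl⟩⟩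

/-- **Constant families of one fixed move instance are move families over any parameter set.**
[Kontsevich–Zagier 2001, §1.2] [folklore] -/
theorem isMoveFamilyOn_const (T : Set ℝ) {c : FormalRep}
    (hc : c ∈ domainAddRel ∪ integrandAddRel ∪ changeOfVariablesRel ∪ newtonLeibnizRel) :
    IsMoveFamilyOn T fun _ => c := by
  rcases hc with ((hc | hc) | hc) | hc
  · exact Or.inl (isDomainAddFamilyOn_const T hc)
  · exact Or.inr (Or.inl (isIntegrandAddFamilyOn_const T hc))
  · exact Or.inr (Or.inr (Or.inl (isChangeOfVariablesFamilyOn_const T hc)))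
  · exact Or.inr (Or.inr (Or.inr (isNewtonLeibnizFamilyOn_const T hc)))

/-- The constant bundled move family of one fixed move instance. [folklore] -/
def MoveFamilyOn.const (T : Set ℝ) (c : FormalRep)
    (hc : c ∈ domainAddRel ∪ integrandAddRel ∪ changeOfVariablesRel ∪ newtonLeibnizRel) :
    MoveFamilyOn T :=
  ⟨fun _ => c, isMoveFamilyOn_const T hc⟩

/-- The underlying family of the constant move family. [folklore] -/
@[simp] theorem MoveFamilyOn.toFun_const (T : Set ℝ) (c : FormalRep)
    (hc : c ∈ domainAddRel ∪ integrandAddRel ∪ changeOfVariablesRel ∪ newtonLeibnizRel) (t : ℝ) :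
    (MoveFamilyOn.const T c hc).toFun t = c := rfl

end Fibres

/-! ### Uniform equivalence: sanity lemmas -/

namespace UniformlyEquivalentOn

variable {T T' : Set ℝ} {R : ℝ → IntegralRep n} {R' : ℝ → IntegralRep m} {t : ℝ}

/-- **Uniform equivalence on `T` implies equivalence of each pair of fibres over `T`**: every
`C i t` is a relation (`IsMoveFamilyOn.mem_relations`) and `relations` is a subgroup.
[Kontsevich–Zagier 2001, §1.2] [folklore] -/
theorem equivalent (h : UniformlyEquivalentOn T R R') (ht : t ∈ T) : Equivalent (R t) (R' t) := by
  obtain ⟨k, C, s, hC, hsum⟩ := h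
  rw [Equivalent, hsum t ht]
  exact relations.sum_mem fun i _ => relations.zsmul_mem ((hC i).mem_relations ht) (s i)

/-- Restriction of a uniform equivalence to a smaller parameter set. [folklore] -/
theorem mono (h : UniformlyEquivalentOn T R R') (hT : T' ⊆ T) : UniformlyEquivalentOn T' R R' := by
  obtain ⟨k, C, s, hC, hsum⟩ := h
  exact ⟨k, C, s, fun i => (hC i).mono hT, fun t ht => hsum t (hT ht)⟩

/-- A uniform equivalence only depends on the families on `T`. [folklore] -/
theorem congr {S : ℝ → IntegralRep n} {S' : ℝ → IntegralRep m} (h : UniformlyEquivalentOn T R R')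
    (hR : EqOn R S T) (hR' : EqOn R' S' T) : UniformlyEquivalentOn T S S' := by
  obtain ⟨k, C, s, hC, hsum⟩ := h
  exact ⟨k, C, s, hC, fun t ht => by rw [← hR ht, ← hR' ht, hsum t ht]⟩

end UniformlyEquivalentOn

/-- The trivial uniform equivalence of a family with itself (empty template). [folklore] -/
theorem uniformlyEquivalentOn_self (T : Set ℝ) (R : ℝ → IntegralRep n) : UniformlyEquivalentOn T R R :=
  ⟨0, Fin.elim0, Fin.elim0, fun i => i.elim0, fun t _ => by simp⟩

/-- **Equivalent representations give uniformly equivalent constant families** over any `T`: a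
relation is a finite `ℤ`-combination of move instances (`AddSubgroup.closure` = `ℤ`-span,
`Submodule.mem_span_set'`), and each move instance is a constant move family
(`isMoveFamilyOn_const`). Together with `UniformlyEquivalentOn.equivalent`: on constant families
(and nonempty `T`) uniform equivalence is exactly `KZ.Equivalent`.
[Kontsevich–Zagier 2001, §1.2] [folklore] -/
theorem Equivalent.uniformlyEquivalentOn_const {r : IntegralRep n} {r' : IntegralRep m}
    (h : Equivalent r r') (T : Set ℝ) : UniformlyEquivalentOn T (fun _ => r) (fun _ => r') := by
  have h' : of r - of r' ∈ Submodule.span ℤ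
      (domainAddRel ∪ integrandAddRel ∪ changeOfVariablesRel ∪ newtonLeibnizRel) := by
    rw [← Submodule.mem_toAddSubgroup, Submodule.span_int_eq_addSubgroupClosure]
    exact h
  obtain ⟨k, s, c, hsum⟩ := Submodule.mem_span_set'.mp h'
  exact ⟨k, fun i _ => (c i : FormalRep), s, fun i => isMoveFamilyOn_const T (c i).2,
    fun _ _ => hsum.symm⟩

/-- On constant families over a nonempty parameter set, uniform equivalence is exactly
`KZ.Equivalent`. [Kontsevich–Zagier 2001, §1.2] [folklore] -/
theorem uniformlyEquivalentOn_const_iff {T : Set ℝ} (hT : T.Nonempty) {r : IntegralRep n}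
    {r' : IntegralRep m} : UniformlyEquivalentOn T (fun _ => r) (fun _ => r') ↔ Equivalent r r' := by
  obtain ⟨t, ht⟩ := hT
  exact ⟨fun h => h.equivalent ht, fun h => h.uniformlyEquivalentOn_const T⟩

end KZ

end Literature.NumberTheory.Transcendental
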